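import Literature.Geometry.Lorentzian.LinearChargeConservation
import Mathlib.Analysis.SpecialFunctions.Sqrt
import Mathlib.Analysis.InnerProductSpace.Calculus
import HarnessLib

/-!
# Stub `stub_schwOutSite` of the line `Sketch` (crux `SwallowTheDatum.UniversalWitnessFamily`,
# item stmt-FinalStateConjecture-10051) — helper file 1: radial calculus of the Schwarzschild far field

The exact time-symmetric isotropic Schwarzschild(`m`) metric field on the parallel frame of `ℝ³` is
`y ↦ (1 + m/(2‖y‖))⁴ • δ`, `δ = innerSL ℝ` (the engine's `schwField m`, file
`SwallowTheDatumParametricKerrBurialEngine.lean`; here always written out, so that this file only depends on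
the Mao–Oh–Tao vocabulary `Literature/Geometry/Lorentzian/ObstructionFreeGluing.lean` and its calculus
companion `LinearChargeConservation.lean`).  This file is the pointwise calculus behind the OUT-charges and the
OUT-deviation of that field on the annulus `{32 ≤ ‖x‖ ≤ 64}`:

* §1 the derivative `φ′_m(r) = −2m(1 + m/(2r))³/r²` of the profile `φ_m(r) = (1 + m/(2r))⁴` and the partials
  `∂_l (φ_m ∘ ‖·‖)(x) = φ′_m(‖x‖) x_l/‖x‖` (chain rule through `MaoOhTao.hasFDerivAt_norm_E3`);
* §2 the components `g_{ij}(x) = φ_m(‖x‖) δ_{ij}` and partials `∂_l g_{ij}(x) = δ_{ij} φ′_m(‖x‖) x_l/‖x‖`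
  of ANY coefficient field `g` that has the Schwarzschild germ at `x ≠ 0`;
* §3 the energy-flux sum `Σ_{ij} (∂_i g_{ij} − ∂_j g_{ii}) x_j/‖x‖ = 4m(1 + m/(2‖x‖))³/‖x‖²`
  (Mao–Oh–Tao (1.3)) and the centre-of-mass flux sum of (1.5),
  `= x_l · (4m(1 + m/(2‖x‖))³/‖x‖² + 2(φ_m(‖x‖) − 1)/‖x‖)` (odd in `x`);
* §4 the `C²` deviation: `φ_m(‖y‖) • δ − δ = 4m F₁ + 6m² F₂ + 4m³ F₃ + m⁴ F₄`, `F_k(y) = (2‖y‖)^{-k} • δ`,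
  whence, by continuity of `D^j F_k` on the compact annulus, an absolute constant `c` with
  `‖D^j(φ_m(‖·‖) • δ − δ)(x)‖ ≤ c·m` for `j ≤ 2`, `32 ≤ ‖x‖ ≤ 64`, `0 ≤ m ≤ 1` (no derivative is
  computed: compactness).

References: Mao–Oh–Tao arXiv:2308.13031 §1.2 (1.3)–(1.7), Rem 1.11; the crux directory's `PICKED.md`.
-/

-- `Summit.<Summit>.<Problem>` is the tree's mandated summit-side namespace (CONVENTIONS §2); for this
-- single-conjunct summit the two coincide, so the duplicate is deliberate.
set_option linter.dupNamespace false

noncomputable section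

-- instance search through the nested operator types `E3 →L E3 →L ℝ`
set_option maxSynthPendingDepth 3

namespace Summit.FinalStateConjecture.FinalStateConjecture.Theorems.SwallowTheDatum.UniversalWitnessFamily

open scoped ContDiff Topology BigOperators InnerProductSpace
open Set Filter Function Literature.Geometry.Lorentzian
open Literature.Geometry.Lorentzian.MaoOhTao

/-! ## §1 The radial profile -/

/-- `d/dr (1 + m/(2r))⁴ = −2m(1 + m/(2r))³/r²` for `r ≠ 0`. [folklore] -/
theorem hasDerivAt_prof (m : ℝ) {r : ℝ} (hr : r ≠ 0) :
    HasDerivAt (fun r : ℝ ↦ (1 + m / (2 * r)) ^ 4) (-(2 * m * (1 + m / (2 * r)) ^ 3 / r ^ 2)) r := by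
  have h1 : HasDerivAt (fun r : ℝ ↦ 1 + m / (2 * r)) (-(m / (2 * r ^ 2))) r := by
    have h := ((hasDerivAt_inv hr).const_mul (m / 2)).const_add 1
    have e1 : (fun r : ℝ ↦ 1 + m / (2 * r)) = fun x ↦ 1 + m / 2 * x⁻¹ := by
      funext s; ring
    rw [e1]
    refine h.congr_deriv ?_
    ring
  refine (h1.fun_pow 4).congr_deriv ?_
  push_cast
  ring

/-- The scalar profile `y ↦ (1 + m/(2‖y‖))⁴` has partials `−2m(1 + m/(2‖x‖))³/‖x‖² · x_l/‖x‖`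
at `x ≠ 0`. [folklore] -/
theorem fderiv_prof_norm_apply (m : ℝ) {x : E3} (hx : x ≠ 0) (l : Fin 3) :
    fderiv ℝ (fun y : E3 ↦ (1 + m / (2 * ‖y‖)) ^ 4) x (e l) =
      -(2 * m * (1 + m / (2 * ‖x‖)) ^ 3 / ‖x‖ ^ 2) * (x l / ‖x‖) := by
  have h := (hasDerivAt_prof m (norm_ne_zero_iff.2 hx)).comp_hasFDerivAt x (hasFDerivAt_norm_E3 hx)
  rw [show (fun y : E3 ↦ (1 + m / (2 * ‖y‖)) ^ 4) =
      (fun r : ℝ ↦ (1 + m / (2 * r)) ^ 4) ∘ (fun y : E3 ↦ ‖y‖) from rfl, h.fderiv]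
  simp only [FunLike.coe_smul, Pi.smul_apply, smul_eq_mul, e, innerSL_apply_apply (𝕜 := ℝ),
    EuclideanSpace.inner_single_right, RCLike.conj_to_real, one_mul]
  ring

/-- The scalar profile is differentiable away from the origin. [folklore] -/
theorem differentiableAt_prof_norm (m : ℝ) {x : E3} (hx : x ≠ 0) :
    DifferentiableAt ℝ (fun y : E3 ↦ (1 + m / (2 * ‖y‖)) ^ 4) x :=
  ((hasDerivAt_prof m (norm_ne_zero_iff.2 hx)).comp_hasFDerivAt x
    (hasFDerivAt_norm_E3 hx)).differentiableAt

/-! ## §2 Components and partials of a field with the Schwarzschild germ at a point -/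

/-- Components of the Schwarzschild field: `g_{ij}(y) = (1 + m/(2‖y‖))⁴ δ_{ij}`. [folklore] -/
theorem cmp_schw (m : ℝ) (i j : Fin 3) :
    cmp (fun y : E3 ↦ (1 + m / (2 * ‖y‖)) ^ 4 • innerSL ℝ) i j =
      fun y ↦ (if i = j then 1 else 0) * (1 + m / (2 * ‖y‖)) ^ 4 := by
  funext y
  simp only [MaoOhTao.cmp, e, FunLike.coe_smul, Pi.smul_apply, smul_eq_mul,
    innerSL_apply_apply (𝕜 := ℝ), EuclideanSpace.inner_single_left, map_one, one_mul,
    PiLp.ofLp_single, Pi.single_apply]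
  split_ifs <;> simp

section NearSchw

variable {m : ℝ} {g : E3 → E3 →L[ℝ] E3 →L[ℝ] ℝ} {x : E3}

/-- If `g` has the Schwarzschild germ at `x`, its components at `x` are `(1 + m/(2‖x‖))⁴ δ_{ij}`. [folklore] -/
theorem cmp_eq_of_eventuallyEq (hg : g =ᶠ[𝓝 x] fun y : E3 ↦ (1 + m / (2 * ‖y‖)) ^ 4 • innerSL ℝ)
    (i j : Fin 3) : cmp g i j x = (if i = j then 1 else 0) * (1 + m / (2 * ‖x‖)) ^ 4 := by
  have h1 : cmp g i j x = cmp (fun y : E3 ↦ (1 + m / (2 * ‖y‖)) ^ 4 • innerSL ℝ) i j x := by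
    simp only [MaoOhTao.cmp, hg.eq_of_nhds]
  rw [h1, cmp_schw]

/-- If `g` has the Schwarzschild germ at `x`, its components have the germ of `(1 + m/(2‖y‖))⁴ δ_{ij}`.
[folklore] -/
theorem cmp_eventuallyEq (hg : g =ᶠ[𝓝 x] fun y : E3 ↦ (1 + m / (2 * ‖y‖)) ^ 4 • innerSL ℝ)
    (i j : Fin 3) : cmp g i j =ᶠ[𝓝 x] fun y ↦ (if i = j then 1 else 0) * (1 + m / (2 * ‖y‖)) ^ 4 := by
  rw [← cmp_schw m i j]
  filter_upwards [hg] with y hy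
  simp only [MaoOhTao.cmp, hy]

/-- **Partials of the Schwarzschild components**: if `g` has the Schwarzschild germ at `x ≠ 0` then
`∂_l g_{ij}(x) = δ_{ij} · (−2m(1 + m/(2‖x‖))³/‖x‖²) · x_l/‖x‖`. [folklore] -/
theorem pd_cmp_eq_of_eventuallyEq (hg : g =ᶠ[𝓝 x] fun y : E3 ↦ (1 + m / (2 * ‖y‖)) ^ 4 • innerSL ℝ)
    (hx : x ≠ 0) (l i j : Fin 3) :
    pd l (cmp g i j) x =
      (if i = j then 1 else 0) * (-(2 * m * (1 + m / (2 * ‖x‖)) ^ 3 / ‖x‖ ^ 2) * (x l / ‖x‖)) := by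
  unfold pd
  rw [(cmp_eventuallyEq hg i j).fderiv_eq, fderiv_const_mul (differentiableAt_prof_norm m hx)]
  simp only [FunLike.coe_smul, Pi.smul_apply, smul_eq_mul, fderiv_prof_norm_apply m hx l]

/-! ## §3 The energy and centre-of-mass flux sums -/

/-- **Energy flux of the Schwarzschild field** (the integrand sum of Mao–Oh–Tao (1.3)):
`Σ_{ij} (∂_i g_{ij} − ∂_j g_{ii}) x_j/‖x‖ = 4m(1 + m/(2‖x‖))³/‖x‖²` at every `x ≠ 0` where `g` has the
Schwarzschild germ. [folklore] -/
theorem sumE_eq (hg : g =ᶠ[𝓝 x] fun y : E3 ↦ (1 + m / (2 * ‖y‖)) ^ 4 • innerSL ℝ) (hx : x ≠ 0) :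
    ∑ i, ∑ j, (pd i (cmp g i j) x - pd j (cmp g i i) x) * (x j / ‖x‖) =
      4 * m * (1 + m / (2 * ‖x‖)) ^ 3 / ‖x‖ ^ 2 := by
  have hn : ‖x‖ ≠ 0 := norm_ne_zero_iff.2 hx
  have hs : x 0 ^ 2 + x 1 ^ 2 + x 2 ^ 2 = ‖x‖ ^ 2 := by
    rw [EuclideanSpace.real_norm_sq_eq x, Fin.sum_univ_three]
  have key : ∑ i, ∑ j, (pd i (cmp g i j) x - pd j (cmp g i i) x) * (x j / ‖x‖) =
      -2 * (-(2 * m * (1 + m / (2 * ‖x‖)) ^ 3 / ‖x‖ ^ 2)) * ((x 0 ^ 2 + x 1 ^ 2 + x 2 ^ 2) / ‖x‖ ^ 2) := by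
    simp only [pd_cmp_eq_of_eventuallyEq hg hx, Fin.sum_univ_three, Fin.isValue]
    simp only [↓reduceIte, Fin.reduceEq, one_mul, zero_mul, zero_sub, Fin.isValue]
    ring
  rw [key, hs, div_self (pow_ne_zero 2 hn), mul_one]
  ring

/-- **Centre-of-mass flux of the Schwarzschild field is odd** (the integrand sum of Mao–Oh–Tao (1.5)): it equals
`x_l · (4m(1 + m/(2‖x‖))³/‖x‖² + 2((1 + m/(2‖x‖))⁴ − 1)/‖x‖)` at every `x ≠ 0` where `g` has the Schwarzschild
germ. [folklore] -/
theorem sumC_eq (hg : g =ᶠ[𝓝 x] fun y : E3 ↦ (1 + m / (2 * ‖y‖)) ^ 4 • innerSL ℝ) (hx : x ≠ 0)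
    (l : Fin 3) :
    ∑ i, ∑ j, (x l * pd i (cmp g i j) x - x l * pd j (cmp g i i) x
      - (if i = l then cmp g i j x - (if i = j then 1 else 0) else 0)
      + (if j = l then cmp g i i x - 1 else 0)) * (x j / ‖x‖) =
      x l * (4 * m * (1 + m / (2 * ‖x‖)) ^ 3 / ‖x‖ ^ 2 + 2 * ((1 + m / (2 * ‖x‖)) ^ 4 - 1) / ‖x‖) := by
  have hn : ‖x‖ ≠ 0 := norm_ne_zero_iff.2 hx
  have hs : x 0 ^ 2 + x 1 ^ 2 + x 2 ^ 2 = ‖x‖ ^ 2 := by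
    rw [EuclideanSpace.real_norm_sq_eq x, Fin.sum_univ_three]
  have key : ∑ i, ∑ j, (x l * pd i (cmp g i j) x - x l * pd j (cmp g i i) x
      - (if i = l then cmp g i j x - (if i = j then 1 else 0) else 0)
      + (if j = l then cmp g i i x - 1 else 0)) * (x j / ‖x‖) =
      x l * (-2 * (-(2 * m * (1 + m / (2 * ‖x‖)) ^ 3 / ‖x‖ ^ 2)) * ((x 0 ^ 2 + x 1 ^ 2 + x 2 ^ 2) / ‖x‖ ^ 2)
        + 2 * ((1 + m / (2 * ‖x‖)) ^ 4 - 1) / ‖x‖) := by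
    simp only [pd_cmp_eq_of_eventuallyEq hg hx, cmp_eq_of_eventuallyEq hg, Fin.sum_univ_three, Fin.isValue]
    fin_cases l <;>
    · simp only [↓reduceIte, Fin.reduceEq, one_mul, zero_mul, Fin.isValue, Fin.zero_eta, Fin.mk_one,
        Fin.reduceFinMk, sub_zero, add_zero]
      ring
  rw [key, hs, div_self (pow_ne_zero 2 hn), mul_one]
  ring

end NearSchw

/-! ## §4 The `C²` deviation of the Schwarzschild field from `δ` on the annulus -/

/-- The monomials `F_k(y) = (2‖y‖)^{-k} • δ` are smooth away from the origin. [folklore] -/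
theorem contDiffAt_Fk (k : ℕ) {x : E3} (hx : x ≠ 0) {n : WithTop ℕ∞} :
    ContDiffAt ℝ n (fun y : E3 ↦ ((2 * ‖y‖)⁻¹) ^ k • (innerSL ℝ : E3 →L[ℝ] E3 →L[ℝ] ℝ)) x := by
  have h1 : ContDiffAt ℝ n (fun y : E3 ↦ ‖y‖) x := contDiffAt_norm ℝ hx
  have h2 : ContDiffAt ℝ n (fun y : E3 ↦ ((2 * ‖y‖)⁻¹) ^ k) x :=
    ((contDiffAt_const.mul h1).inv (by simp [norm_ne_zero_iff.2 hx])).pow k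
  exact h2.smul contDiffAt_const

/-- **Binomial expansion**: `(1 + m/(2‖y‖))⁴ • δ − δ = 4m F₁ + 6m² F₂ + 4m³ F₃ + m⁴ F₄`,
`F_k(y) = (2‖y‖)^{-k} • δ`. [folklore] -/
theorem schw_sub_flat_eq (m : ℝ) :
    (fun y : E3 ↦ (1 + m / (2 * ‖y‖)) ^ 4 • (innerSL ℝ : E3 →L[ℝ] E3 →L[ℝ] ℝ) - innerSL ℝ) =
      (4 * m) • (fun y : E3 ↦ ((2 * ‖y‖)⁻¹) ^ 1 • (innerSL ℝ : E3 →L[ℝ] E3 →L[ℝ] ℝ))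
        + (6 * m ^ 2) • (fun y : E3 ↦ ((2 * ‖y‖)⁻¹) ^ 2 • (innerSL ℝ : E3 →L[ℝ] E3 →L[ℝ] ℝ))
        + (4 * m ^ 3) • (fun y : E3 ↦ ((2 * ‖y‖)⁻¹) ^ 3 • (innerSL ℝ : E3 →L[ℝ] E3 →L[ℝ] ℝ))
        + m ^ 4 • (fun y : E3 ↦ ((2 * ‖y‖)⁻¹) ^ 4 • (innerSL ℝ : E3 →L[ℝ] E3 →L[ℝ] ℝ)) := by
  funext y
  simp only [Pi.add_apply, Pi.smul_apply, smul_smul]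
  rw [← add_smul, ← add_smul, ← add_smul]
  have h1 : (1 + m / (2 * ‖y‖)) ^ 4 • (innerSL ℝ : E3 →L[ℝ] E3 →L[ℝ] ℝ) - innerSL ℝ =
      ((1 + m / (2 * ‖y‖)) ^ 4 - 1) • (innerSL ℝ : E3 →L[ℝ] E3 →L[ℝ] ℝ) := by
    rw [sub_smul, one_smul]
  rw [h1]
  congr 1
  ring

/-- Each `D^j F_k`, `F_k(y) = (2‖y‖)^{-k} • δ`, is bounded on the compact annulus `{32 ≤ ‖x‖ ≤ 64}`
(continuity of the iterated derivative of a function smooth on the open set `{1 < ‖y‖}`). [folklore] -/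
theorem exists_bound_Fk (k j : ℕ) :
    ∃ B : ℝ, 0 ≤ B ∧ ∀ x : E3, 32 ≤ ‖x‖ → ‖x‖ ≤ 64 →
      ‖iteratedFDeriv ℝ j (fun y : E3 ↦ ((2 * ‖y‖)⁻¹) ^ k • (innerSL ℝ : E3 →L[ℝ] E3 →L[ℝ] ℝ)) x‖ ≤ B := by
  set F : E3 → E3 →L[ℝ] E3 →L[ℝ] ℝ := fun y : E3 ↦ ((2 * ‖y‖)⁻¹) ^ k • innerSL ℝ with hF_def
  set U : Set E3 := {y | 1 < ‖y‖} with hU_def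
  have hU : IsOpen U := isOpen_lt continuous_const continuous_norm
  have hcd : ContDiffOn ℝ (j : ℕ∞) F U := fun y hy ↦
    (contDiffAt_Fk k (norm_pos_iff.1 (lt_trans one_pos hy))).contDiffWithinAt
  have hc1 : ContinuousOn (iteratedFDerivWithin ℝ j F U) U :=
    hcd.continuousOn_iteratedFDerivWithin le_rfl hU.uniqueDiffOn
  have hc2 : ContinuousOn (iteratedFDeriv ℝ j F) U :=
    hc1.congr fun y hy ↦ (iteratedFDerivWithin_of_isOpen j hU hy).symm
  set A : Set E3 := {y | 32 ≤ ‖y‖} ∩ {y | ‖y‖ ≤ 64} with hA_def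
  have hAc : IsClosed A :=
    (isClosed_le continuous_const continuous_norm).inter (isClosed_le continuous_norm continuous_const)
  have hA : IsCompact A :=
    (isCompact_closedBall (0 : E3) 64).of_isClosed_subset hAc fun y hy ↦ mem_closedBall_zero_iff.2 hy.2
  have hAU : A ⊆ U := fun y hy ↦ show (1 : ℝ) < ‖y‖ from lt_of_lt_of_le (by norm_num) hy.1
  obtain ⟨C, hC⟩ := hA.exists_bound_of_continuousOn (hc2.mono hAU)
  exact ⟨max C 0, le_max_right _ _, fun x h1 h2 ↦ (hC x ⟨h1, h2⟩).trans (le_max_left _ _)⟩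

/-- The iterated derivative of a four-term linear combination is bounded by the combination of the iterated
derivatives (linearity of `iteratedFDeriv` at a point of smoothness). [folklore] -/
theorem norm_iteratedFDeriv_comb4_le {f₁ f₂ f₃ f₄ : E3 → E3 →L[ℝ] E3 →L[ℝ] ℝ} {x : E3} {j : ℕ}
    (h₁ : ContDiffAt ℝ j f₁ x) (h₂ : ContDiffAt ℝ j f₂ x) (h₃ : ContDiffAt ℝ j f₃ x)
    (h₄ : ContDiffAt ℝ j f₄ x) (a₁ a₂ a₃ a₄ : ℝ) :
    ‖iteratedFDeriv ℝ j (a₁ • f₁ + a₂ • f₂ + a₃ • f₃ + a₄ • f₄) x‖ ≤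
      |a₁| * ‖iteratedFDeriv ℝ j f₁ x‖ + |a₂| * ‖iteratedFDeriv ℝ j f₂ x‖
        + |a₃| * ‖iteratedFDeriv ℝ j f₃ x‖ + |a₄| * ‖iteratedFDeriv ℝ j f₄ x‖ := by
  have c1 : ContDiffAt ℝ j (a₁ • f₁) x := h₁.const_smul a₁
  have c2 : ContDiffAt ℝ j (a₂ • f₂) x := h₂.const_smul a₂
  have c3 : ContDiffAt ℝ j (a₃ • f₃) x := h₃.const_smul a₃
  have c4 : ContDiffAt ℝ j (a₄ • f₄) x := h₄.const_smul a₄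
  have c12 : ContDiffAt ℝ j (a₁ • f₁ + a₂ • f₂) x := c1.add c2
  have c123 : ContDiffAt ℝ j (a₁ • f₁ + a₂ • f₂ + a₃ • f₃) x := c12.add c3
  rw [iteratedFDeriv_add_apply c123 c4, iteratedFDeriv_add_apply c12 c3, iteratedFDeriv_add_apply c1 c2,
    iteratedFDeriv_const_smul_apply h₁, iteratedFDeriv_const_smul_apply h₂,
    iteratedFDeriv_const_smul_apply h₃, iteratedFDeriv_const_smul_apply h₄]
  calc _ ≤ ‖a₁ • iteratedFDeriv ℝ j f₁ x‖ + ‖a₂ • iteratedFDeriv ℝ j f₂ x‖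
        + ‖a₃ • iteratedFDeriv ℝ j f₃ x‖ + ‖a₄ • iteratedFDeriv ℝ j f₄ x‖ :=
        norm_add_le_of_le (norm_add_le_of_le (norm_add_le _ _) le_rfl) le_rfl
    _ = _ := by simp only [norm_smul, Real.norm_eq_abs]

/-- **`C²` deviation of the Schwarzschild far field is `O(m)`**: there is an absolute constant `c > 0` with
`‖D^j((1 + m/(2‖·‖))⁴ • δ − δ)(x)‖ ≤ c·m` for `j ≤ 2`, `32 ≤ ‖x‖ ≤ 64`, `0 ≤ m ≤ 1`. [folklore] -/
theorem exists_devBound :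
    ∃ c : ℝ, 0 < c ∧ ∀ m : ℝ, 0 ≤ m → m ≤ 1 → ∀ j : ℕ, j ≤ 2 → ∀ x : E3, 32 ≤ ‖x‖ → ‖x‖ ≤ 64 →
      ‖iteratedFDeriv ℝ j
        (fun y : E3 ↦ (1 + m / (2 * ‖y‖)) ^ 4 • (innerSL ℝ : E3 →L[ℝ] E3 →L[ℝ] ℝ) - innerSL ℝ) x‖ ≤ c * m := by
  have hb : ∀ k : ℕ, ∃ B : ℝ, 0 ≤ B ∧ ∀ j : ℕ, j ≤ 2 → ∀ x : E3, 32 ≤ ‖x‖ → ‖x‖ ≤ 64 →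
      ‖iteratedFDeriv ℝ j (fun y : E3 ↦ ((2 * ‖y‖)⁻¹) ^ k • (innerSL ℝ : E3 →L[ℝ] E3 →L[ℝ] ℝ)) x‖ ≤ B := by
    intro k
    obtain ⟨B0, h0, hB0⟩ := exists_bound_Fk k 0
    obtain ⟨B1, h1, hB1⟩ := exists_bound_Fk k 1
    obtain ⟨B2, h2, hB2⟩ := exists_bound_Fk k 2
    refine ⟨B0 + B1 + B2, by positivity, fun j hj x hx1 hx2 ↦ ?_⟩
    interval_cases j
    · linarith [hB0 x hx1 hx2]
    · linarith [hB1 x hx1 hx2]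
    · linarith [hB2 x hx1 hx2]
  obtain ⟨B1, hB1, h1⟩ := hb 1
  obtain ⟨B2, hB2, h2⟩ := hb 2
  obtain ⟨B3, hB3, h3⟩ := hb 3
  obtain ⟨B4, hB4, h4⟩ := hb 4
  refine ⟨4 * B1 + 6 * B2 + 4 * B3 + B4 + 1, by positivity, ?_⟩
  intro m hm0 hm1 j hj x hx1 hx2
  have hx : x ≠ 0 := norm_pos_iff.1 (lt_of_lt_of_le (by norm_num) hx1)
  -- scalar bookkeeping first (so that `nlinarith` never sees the operator norms)
  have hp2 : m ^ 2 ≤ m := by nlinarith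
  have hp3 : m ^ 3 ≤ m := by nlinarith
  have hp4 : m ^ 4 ≤ m := by nlinarith
  have hm2 : 6 * m ^ 2 * B2 ≤ 6 * m * B2 := by
    have := mul_le_mul_of_nonneg_right hp2 hB2
    linarith
  have hm3 : 4 * m ^ 3 * B3 ≤ 4 * m * B3 := by
    have := mul_le_mul_of_nonneg_right hp3 hB3
    linarith
  have hm4 : m ^ 4 * B4 ≤ m * B4 := mul_le_mul_of_nonneg_right hp4 hB4
  have hfin : 4 * m * B1 + 6 * m * B2 + 4 * m * B3 + m * B4 ≤ (4 * B1 + 6 * B2 + 4 * B3 + B4 + 1) * m := by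
    nlinarith
  have hA : ∀ k : ℕ,
      ContDiffAt ℝ (j : ℕ∞) (fun y : E3 ↦ ((2 * ‖y‖)⁻¹) ^ k • (innerSL ℝ : E3 →L[ℝ] E3 →L[ℝ] ℝ)) x :=
    fun k ↦ contDiffAt_Fk k hx
  have key := norm_iteratedFDeriv_comb4_le (hA 1) (hA 2) (hA 3) (hA 4) (4 * m) (6 * m ^ 2) (4 * m ^ 3) (m ^ 4)
  rw [abs_of_nonneg (by positivity : 0 ≤ 4 * m), abs_of_nonneg (by positivity : 0 ≤ 6 * m ^ 2),
    abs_of_nonneg (by positivity : 0 ≤ 4 * m ^ 3), abs_of_nonneg (by positivity : 0 ≤ m ^ 4)] at key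
  rw [schw_sub_flat_eq]
  refine key.trans (le_trans ?_ hfin)
  have t1 := mul_le_mul_of_nonneg_left (h1 j hj x hx1 hx2) (by positivity : 0 ≤ 4 * m)
  have t2 := (mul_le_mul_of_nonneg_left (h2 j hj x hx1 hx2) (by positivity : 0 ≤ 6 * m ^ 2)).trans hm2
  have t3 := (mul_le_mul_of_nonneg_left (h3 j hj x hx1 hx2) (by positivity : 0 ≤ 4 * m ^ 3)).trans hm3
  have t4 := (mul_le_mul_of_nonneg_left (h4 j hj x hx1 hx2) (by positivity : 0 ≤ m ^ 4)).trans hm4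
  exact add_le_add (add_le_add (add_le_add t1 t2) t3) t4

/-! ## Anchor -/

/-- **Anchor of this helper file** (registered sub-goal `schwOutSiteAux1_anchor` of item 10051): the radial
derivative of the conformal profile, `d/dr (1 + m/(2r))⁴ = −2m(1 + m/(2r))³/r²` (`hasDerivAt_prof`). -/
theorem schwOutSiteAux1_anchor : ∀ (m r : ℝ), r ≠ 0 → HasDerivAt (fun r : ℝ ↦ (1 + m / (2 * r)) ^ 4) (-(2 * m * (1 + m / (2 * r)) ^ 3 / r ^ 2)) r :=
  fun m _ hr ↦ hasDerivAt_prof m hr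

end Summit.FinalStateConjecture.FinalStateConjecture.Theorems.SwallowTheDatum.UniversalWitnessFamily

end
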